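import Mathlib
import Summits.QuantumFields.YangMills.Theses.IsotropyFromPowerCounting

/-!
# Stub `stub_chainOrdered` for the crux `CurvatureSandwichBound` (line `Sketch`)

Osterwalder–Schrader support bookkeeping on `(ℝ⁴)ⁿ` (time = coordinate `0`) for the chain step of the
heat-sandwich / multiple-reflection argument.  With `s = 2u + v`, `T_s = translateMulti (s • e₀)`,
`X G = f₁ ⊗ T_s G` and `P G = T_s (f₁† ⊗ X G)` (`f₁† = osAdjoint f₁`): if `tsupport f₁ ⊆ {u ≤ x⁰ ≤ 2u}`
and `X G` is time-ordered, then `P G` is time-ordered (its blocks sit at times `[v, u + v]`, then `> s`,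
strictly increasing), and so is `X (P G) = f₁ ⊗ T_s (P G)` (the `f₁`-point has time `≤ 2u < s <` the
times of `T_s (P G)`).

Contents: `timeOrdered_of_head_tail` (the index combinatorics on `Fin (1 + m)`: a positive head below a
strictly increasing tail is time-ordered), `smul_single_apply_zero` (`(s • e₀)⁰ = s`) and the stub itself.

References: K. Osterwalder, R. Schrader, Comm. Math. Phys. 31 (1973) §2, §4.1; J. Glimm, A. Jaffe,
Quantum Physics (1987) §6.1, Thm 10.5.5.
-/

noncomputable section

namespace Summit.QuantumFields.YangMills.Theorems.CurvatureSandwichBound.Sketch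

open scoped BigOperators SchwartzMap InnerProductSpace
open MeasureTheory Filter Topology
open Literature.MathematicalPhysics.QuantumLattice Literature.MathematicalPhysics.AQFT
  Literature.MathematicalPhysics.QuantumFieldTheory Literature.Probability.LatticeModels
open Summit.QuantumFields.YangMills.Theorems.NPointIsotropy.Negative (E4)

/-- The time component of the time-shift vector `s • e₀ ∈ ℝ⁴` is `s`. -/
theorem smul_single_apply_zero (s : ℝ) : (s • EuclideanSpace.single 0 1 : E4) 0 = s := by
  simp

/-- **Head–tail criterion for time-ordering on `Fin (1 + m)`.**  If the head point `x₀` has positive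
time, lies strictly below every tail point `x_{1+j}` in time, and the tail times are strictly
increasing, then all times are positive and strictly increasing in the index. -/
theorem timeOrdered_of_head_tail {m : ℕ} (x : Fin (1 + m) → E4)
    (h0 : 0 < x (Fin.castAdd m 0) 0)
    (h1 : ∀ j : Fin m, x (Fin.castAdd m 0) 0 < x (Fin.natAdd 1 j) 0)
    (h2 : StrictMono fun j : Fin m => x (Fin.natAdd 1 j) 0) :
    (∀ i, 0 < x i 0) ∧ StrictMono fun i => x i 0 := by
  have hcast : ∀ i : Fin 1, Fin.castAdd m i = Fin.castAdd m 0 := fun i =>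
    congrArg _ (Subsingleton.elim i 0)
  refine ⟨fun i => ?_, fun i j hij => ?_⟩
  · induction i using Fin.addCases with
    | left i => rw [hcast i]; exact h0
    | right j => exact h0.trans (h1 j)
  · induction i using Fin.addCases with
    | left i =>
      induction j using Fin.addCases with
      | left j =>
        exfalso
        rw [hcast i, hcast j] at hij
        exact lt_irrefl _ hij
      | right j =>
        show x (Fin.castAdd m i) 0 < x (Fin.natAdd 1 j) 0
        rw [hcast i]
        exact h1 j
    | right i =>
      induction j using Fin.addCases with
      | left j =>
        exfalso
        have hj := j.isLt
        rw [Fin.lt_def, Fin.val_natAdd, Fin.val_castAdd] at hij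
        omega
      | right j =>
        have hij' : i < j := by
          rw [Fin.lt_def, Fin.val_natAdd, Fin.val_natAdd] at hij
          rw [Fin.lt_def]
          omega
        exact h2 hij'

/-- **Stub (CO) — the chain step preserves admissibility (support bookkeeping).**  With `s = 2u+v`,
`f₁` supported in the time window `[u, 2u]` and `X G = f₁ ⊗ T_s G` time-ordered, the chain step
`P G = T_s (f₁† ⊗ f₁ ⊗ T_s G)` (`f₁† = osAdjoint f₁`, supported in times `[-2u, -u]`) is time-ordered
(blocks at times `[v, u+v] < (s, ∞)`, the second block being the translate by `s` of the time-ordered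
`X G`), and so is `X (P G) = f₁ ⊗ T_s (P G)` (head at times `[u, 2u]`, tail at times `> s > 2u`).
Osterwalder–Schrader 1973 §4.1 (`T^t 𝒮₊ ⊆ 𝒮₊`); Glimm–Jaffe 1987 §6.1. -/
theorem stub_chainOrdered (u v : ℝ) (hu : 0 < u) (hv : 0 < v) (f₁ : 𝓢((Fin 1 → E4), ℂ))
    (hf₁ : tsupport (f₁ : (Fin 1 → E4) → ℂ) ⊆ {x | u ≤ x 0 0 ∧ x 0 0 ≤ 2 * u})
    {n : ℕ} (G : 𝓢((Fin n → E4), ℂ))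
    (hXG : IsTimeOrdered
      (f₁.appendTensor (translateMulti ((2 * u + v) • EuclideanSpace.single 0 1) G))) :
    IsTimeOrdered (translateMulti ((2 * u + v) • EuclideanSpace.single 0 1)
        ((osAdjoint f₁).appendTensor
          (f₁.appendTensor (translateMulti ((2 * u + v) • EuclideanSpace.single 0 1) G)))) ∧
      IsTimeOrdered (f₁.appendTensor (translateMulti ((2 * u + v) • EuclideanSpace.single 0 1)
        (translateMulti ((2 * u + v) • EuclideanSpace.single 0 1)
          ((osAdjoint f₁).appendTensor
            (f₁.appendTensor (translateMulti ((2 * u + v) • EuclideanSpace.single 0 1) G)))))) := by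
  have ha0 : ((2 * u + v) • EuclideanSpace.single 0 1 : E4) 0 = 2 * u + v :=
    smul_single_apply_zero _
  have hrev : Fin.rev (0 : Fin 1) = 0 := Subsingleton.elim _ _
  -- (1) the chain step `P G = T_s (f₁† ⊗ X G)` is time-ordered
  have hP : IsTimeOrdered (translateMulti ((2 * u + v) • EuclideanSpace.single 0 1)
      ((osAdjoint f₁).appendTensor
        (f₁.appendTensor (translateMulti ((2 * u + v) • EuclideanSpace.single 0 1) G)))) := by
    intro x hx
    obtain ⟨hyA, hyB⟩ := OSReconstructionNoE1.tsupport_appendTensor_subset _ _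
      (OSReconstructionNoE1.tsupport_translateMulti_subset _ _ hx)
    -- head: the `f₁†`-point, reflected back into the window `[u, 2u]`
    have hf : u ≤ timeReflection 4 (x (Fin.castAdd (1 + n) (Fin.rev 0)) -
          (2 * u + v) • EuclideanSpace.single 0 1) 0 ∧
        timeReflection 4 (x (Fin.castAdd (1 + n) (Fin.rev 0)) -
          (2 * u + v) • EuclideanSpace.single 0 1) 0 ≤ 2 * u :=
      hf₁ (OSReconstructionNoE1.tsupport_osAdjoint_subset f₁ hyA)
    rw [hrev, OSReconstructionNoE1.timeReflection_apply_zero, PiLp.sub_apply, ha0] at hf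
    -- tail: the translate by `s` of the time-ordered `X G`
    have hX : (∀ j, 0 < (x (Fin.natAdd 1 j) - (2 * u + v) • EuclideanSpace.single 0 1 : E4) 0) ∧
        StrictMono fun j => (x (Fin.natAdd 1 j) - (2 * u + v) • EuclideanSpace.single 0 1 : E4) 0 :=
      hXG hyB
    simp only [PiLp.sub_apply, ha0] at hX
    refine timeOrdered_of_head_tail x (by linarith [hf.2]) (fun j => ?_) (fun i j hij => ?_)
    · have := hX.1 j
      linarith [hf.1]
    · have := hX.2 hij
      simp only at this
      linarith
  refine ⟨hP, ?_⟩
  -- (2) `X (P G) = f₁ ⊗ T_s (P G)` is time-ordered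
  intro x hx
  obtain ⟨hxA, hxB⟩ := OSReconstructionNoE1.tsupport_appendTensor_subset _ _ hx
  have hf : u ≤ x (Fin.castAdd (1 + (1 + n)) 0) 0 ∧ x (Fin.castAdd (1 + (1 + n)) 0) 0 ≤ 2 * u :=
    hf₁ hxA
  have hT : (∀ j, 0 < (x (Fin.natAdd 1 j) - (2 * u + v) • EuclideanSpace.single 0 1 : E4) 0) ∧
      StrictMono fun j => (x (Fin.natAdd 1 j) - (2 * u + v) • EuclideanSpace.single 0 1 : E4) 0 :=
    hP (OSReconstructionNoE1.tsupport_translateMulti_subset _ _ hxB)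
  simp only [PiLp.sub_apply, ha0] at hT
  refine timeOrdered_of_head_tail x (by linarith [hf.1]) (fun j => ?_) (fun i j hij => ?_)
  · have := hT.1 j
    linarith [hf.2]
  · have := hT.2 hij
    simp only at this
    linarith

end Summit.QuantumFields.YangMills.Theorems.CurvatureSandwichBound.Sketch

end
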